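import Mathlib
import Summits.AtomisticToContinuum.FouriersLaw.Theorems.EmbeddedDrudeMourreDrudeDissolutionCutoffArguments
import Summits.AtomisticToContinuum.FouriersLaw.Theorems.EmbeddedDrudeMourreDrudeDissolutionCutoffs
import HarnessLib

/-!
# The cutoff family `Θ_η = ∏ₖ ζ(ρₖ/η²)` of the sup-norm route
(crux `EmbeddedDrudeMourre.DrudeDissolution`, item stmt-AtomisticToContinuum-12593; `--supports` file for the
registered sub-goal `exists_cutoff_family` of stub B1b″ `stub_excursionSecondDifference` of line
`kinetic-polymer-gas-on-the-time-axis`; closes nothing; lead c13 (process B), 2026-08-17)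

WHAT. `exists_cutoff_family`: for `ω₂ > 0`, the structure functions `A, S₁, S₂` and an admissible frame `e`,
there are constants `a, b ≥ 0` such that for every `η > 0` the product cutoff
`Θ_η(p) = ∏ₖ₌₁⁵ ζ(ρₖ(p)/η²)` (`ζ` the fixed `C²` profile of `exists_cutoff_profile`, `ρₖ` the five arguments of
`cutoff_arguments`) is `C²`, takes values in `[0,1]`, is `2π`-periodic in each coordinate, vanishes identically
near every point where some `ρₖ < η²`, equals `1` where all `ρₖ ≥ 4η²`, and has
`|∂_{eᵢ}Θ_η| ≤ a/η`, `|∂_{eⱼ}∂_{eᵢ}Θ_η| ≤ b/η²` everywhere.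

HOW. `cutoff_scale_bounds_gen` for each factor (inputs from `cutoff_arguments`), four applications of the
product rule `cutoff_product_bounds_gen` (`cutoff_stage`), `cutoff_vanishes_near`.

WHY (role). Item (C5) of the remaining concrete work for B1b″: the `Θ` of `cube_secondDiff_of_cutoffFamily`.
-/

noncomputable section

open scoped Topology
open Filter Set

namespace Summit.AtomisticToContinuum.FouriersLaw.Theorems.DrudeDissolution.KineticPolymerGasOnTheTimeAxis

open Literature.MathematicalPhysics.KineticTheory
open Literature.MathematicalPhysics.KineticTheory.PhononBoltzmann

/-- **One product stage.** Two `C²` factors with values in `[0,1]`, first derivatives along `u` and `v` bounded by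
`α/η`, `α'/η` and mixed second derivative bounded by `β/η²`, `β'/η²` at `p`, give a product with the same
structure and constants `α+α'`, `β + 2αα' + β'`. [folklore] -/
theorem cutoff_stage {V : Type*} [NormedAddCommGroup V] [NormedSpace ℝ V] {F G : V → ℝ}
    (hF : ContDiff ℝ 2 F) (hG : ContDiff ℝ 2 G) (hF01 : ∀ q, 0 ≤ F q ∧ F q ≤ 1) (hG01 : ∀ q, 0 ≤ G q ∧ G q ≤ 1)
    {η α α' β β' : ℝ} (hη : 0 < η) (p u v : V)
    (hFu : |fderiv ℝ F p u| ≤ α / η) (hFv : |fderiv ℝ F p v| ≤ α / η)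
    (hGu : |fderiv ℝ G p u| ≤ α' / η) (hGv : |fderiv ℝ G p v| ≤ α' / η)
    (hFuv : |fderiv ℝ (fun q => fderiv ℝ F q u) p v| ≤ β / η ^ 2)
    (hGuv : |fderiv ℝ (fun q => fderiv ℝ G q u) p v| ≤ β' / η ^ 2) :
    ContDiff ℝ 2 (fun q => F q * G q) ∧ (∀ q, 0 ≤ F q * G q ∧ F q * G q ≤ 1) ∧
      |fderiv ℝ (fun q => F q * G q) p u| ≤ (α + α') / η ∧ |fderiv ℝ (fun q => F q * G q) p v| ≤ (α + α') / η ∧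
      |fderiv ℝ (fun q => fderiv ℝ (fun r => F r * G r) q u) p v| ≤ (β + 2 * α * α' + β') / η ^ 2 := by
  obtain ⟨hC, -, h1, h2⟩ := cutoff_product_bounds_gen hF hG hF01 hG01 hη p u v hFu hFv hGu hGv hFuv hGuv
  -- the `v`-derivative: the same lemma with `u := v` (its second-derivative input along `(v,v)` is not
  -- needed for the first-derivative output, so we feed the available mixed bounds through a direct computation)
  have hdF : Differentiable ℝ F := hF.differentiable (by norm_num)
  have hdG : Differentiable ℝ G := hG.differentiable (by norm_num)
  have hv : |fderiv ℝ (fun q => F q * G q) p v| ≤ (α + α') / η := by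
    rw [fp_mul (hdF p) (hdG p)]
    have hα0 : 0 ≤ α / η := (abs_nonneg _).trans hFv
    calc |fderiv ℝ F p v * G p + F p * fderiv ℝ G p v|
        ≤ |fderiv ℝ F p v * G p| + |F p * fderiv ℝ G p v| := abs_add_le _ _
      _ = |fderiv ℝ F p v| * G p + F p * |fderiv ℝ G p v| := by
          rw [abs_mul, abs_mul, abs_of_nonneg (hG01 p).1, abs_of_nonneg (hF01 p).1]
      _ ≤ α / η * 1 + 1 * (α' / η) :=
          add_le_add (mul_le_mul hFv (hG01 p).2 (hG01 p).1 hα0)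
            (mul_le_mul (hF01 p).2 hGv (abs_nonneg _) zero_le_one)
      _ = (α + α') / η := by ring
  refine ⟨hC, fun q => ⟨mul_nonneg (hF01 q).1 (hG01 q).1, ?_⟩, h1, hv, h2⟩
  calc F q * G q ≤ 1 * 1 := mul_le_mul (hF01 q).2 (hG01 q).2 (hG01 q).1 zero_le_one
    _ = 1 := one_mul _

/-- **Registered sub-goal `exists_cutoff_family` of stub B1b″ (item (C5)).** See the module docstring.
[folklore] -/
theorem exists_cutoff_family :
    ∀ ω₂ : ℝ, 0 < ω₂ → ∀ (A S₁ S₂ : ℝ × ℝ × ℝ → ℝ),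
      (∀ p : ℝ × ℝ × ℝ, S₁ p = Real.sin ((p.2.1 - p.1) / 2)) →
      (∀ p : ℝ × ℝ × ℝ, S₂ p = Real.sin ((p.2.1 - p.2.2) / 2)) →
      (∀ p : ℝ × ℝ × ℝ, A p =
        8 * ((dispersion ω₂ p.1 * dispersion ω₂ p.2.2 +
                dispersion ω₂ p.2.1 * dispersion ω₂ (p.1 + p.2.2 - p.2.1) + 2 * (ω₂ + 2)) *
              Real.cos ((p.1 + p.2.2) / 2) -
            4 * Real.cos ((p.2.1 - p.1) / 2) * Real.cos ((p.2.2 - p.2.1) / 2)) /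
          ((dispersion ω₂ p.1 + dispersion ω₂ p.2.2 + dispersion ω₂ p.2.1 + dispersion ω₂ (p.1 + p.2.2 - p.2.1)) *
            (dispersion ω₂ p.1 * dispersion ω₂ p.2.2 +
              dispersion ω₂ p.2.1 * dispersion ω₂ (p.1 + p.2.2 - p.2.1)))) →
      ∀ e : Fin 3 → ℝ × ℝ × ℝ,
        (∀ i, |(e i).1| ≤ 1 ∧ |(e i).2.1| ≤ 1 ∧ |(e i).2.2| ≤ 1 ∧ |(e i).2.1 - (e i).1| ≤ 1 ∧ |(e i).2.1 - (e i).2.2| ≤ 1) →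
      ∃ a b : ℝ, 0 ≤ a ∧ 0 ≤ b ∧ ∀ η : ℝ, 0 < η → ∃ Θ : ℝ × ℝ × ℝ → ℝ,
        ContDiff ℝ 2 Θ ∧ (∀ p, 0 ≤ Θ p ∧ Θ p ≤ 1) ∧
        (∀ q : ℝ × ℝ × ℝ, Θ (q + (2 * Real.pi, 0, 0)) = Θ q) ∧ (∀ q : ℝ × ℝ × ℝ, Θ (q + (0, 2 * Real.pi, 0)) = Θ q) ∧
        (∀ q : ℝ × ℝ × ℝ, Θ (q + (0, 0, 2 * Real.pi)) = Θ q) ∧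
        (∀ p : ℝ × ℝ × ℝ, (S₁ p ^ 2 + A p ^ 2 < η ^ 2 ∨ S₂ p ^ 2 + A p ^ 2 < η ^ 2 ∨ S₁ p ^ 2 + S₂ p ^ 2 < η ^ 2 ∨
            (1 - Real.cos p.1) + (1 - Real.cos p.2.2) + (1 + Real.cos p.2.1) < η ^ 2 ∨
            (1 + Real.cos p.1) + (1 + Real.cos p.2.2) + (1 - Real.cos p.2.1) < η ^ 2) → Θ =ᶠ[𝓝 p] 0) ∧
        (∀ p : ℝ × ℝ × ℝ, 4 * η ^ 2 ≤ S₁ p ^ 2 + A p ^ 2 → 4 * η ^ 2 ≤ S₂ p ^ 2 + A p ^ 2 →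
            4 * η ^ 2 ≤ S₁ p ^ 2 + S₂ p ^ 2 →
            4 * η ^ 2 ≤ (1 - Real.cos p.1) + (1 - Real.cos p.2.2) + (1 + Real.cos p.2.1) →
            4 * η ^ 2 ≤ (1 + Real.cos p.1) + (1 + Real.cos p.2.2) + (1 - Real.cos p.2.1) → Θ p = 1) ∧
        (∀ (p : ℝ × ℝ × ℝ) (i j : Fin 3), |fderiv ℝ Θ p (e i)| ≤ a / η ∧
            |fderiv ℝ (fun q => fderiv ℝ Θ q (e i)) p (e j)| ≤ b / η ^ 2) := by
  intro ω₂ hω A S₁ S₂ hS₁ hS₂ hA e he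
  obtain ⟨ζ, hζC, hζ01, hζ0, hζ1, hζd0, Z₁, Z₂, hZ⟩ := exists_cutoff_profile
  obtain ⟨K, K₂, hK, hK₂, hρ⟩ := cutoff_arguments ω₂ hω A S₁ S₂ hS₁ hS₂ hA e he
  -- the five arguments as opaque functions
  obtain ⟨ρ₁, hρ₁⟩ : ∃ f : ℝ × ℝ × ℝ → ℝ, f = fun p => S₁ p ^ 2 + A p ^ 2 := ⟨_, rfl⟩
  obtain ⟨ρ₂, hρ₂⟩ : ∃ f : ℝ × ℝ × ℝ → ℝ, f = fun p => S₂ p ^ 2 + A p ^ 2 := ⟨_, rfl⟩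
  obtain ⟨ρ₃, hρ₃⟩ : ∃ f : ℝ × ℝ × ℝ → ℝ, f = fun p => S₁ p ^ 2 + S₂ p ^ 2 := ⟨_, rfl⟩
  obtain ⟨ρ₄, hρ₄⟩ : ∃ f : ℝ × ℝ × ℝ → ℝ,
    f = fun p => (1 - Real.cos p.1) + (1 - Real.cos p.2.2) + (1 + Real.cos p.2.1) := ⟨_, rfl⟩
  obtain ⟨ρ₅, hρ₅⟩ : ∃ f : ℝ × ℝ × ℝ → ℝ,
    f = fun p => (1 + Real.cos p.1) + (1 + Real.cos p.2.2) + (1 - Real.cos p.2.1) := ⟨_, rfl⟩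
  obtain ⟨C1, N1, P1a, P1b, P1c, B1⟩ := hρ ρ₁ (Or.inl hρ₁)
  obtain ⟨C2, N2, P2a, P2b, P2c, B2⟩ := hρ ρ₂ (Or.inr (Or.inl hρ₂))
  obtain ⟨C3, N3, P3a, P3b, P3c, B3⟩ := hρ ρ₃ (Or.inr (Or.inr (Or.inl hρ₃)))
  obtain ⟨C4, N4, P4a, P4b, P4c, B4⟩ := hρ ρ₄ (Or.inr (Or.inr (Or.inr (Or.inl hρ₄))))
  obtain ⟨C5, N5, P5a, P5b, P5c, B5⟩ := hρ ρ₅ (Or.inr (Or.inr (Or.inr (Or.inr hρ₅))))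
  -- the per-factor constants
  set a₀ := 2 * Z₁ * Real.sqrt K with ha₀
  set b₀ := 4 * Z₂ * K + Z₁ * K₂ with hb₀
  have hZ₁ : 0 ≤ Z₁ := (abs_nonneg _).trans (hZ 0).1
  have hZ₂ : 0 ≤ Z₂ := (abs_nonneg _).trans (hZ 0).2
  have ha₀0 : 0 ≤ a₀ := by rw [ha₀]; positivity
  have hb₀0 : 0 ≤ b₀ := by rw [hb₀]; positivity
  refine ⟨5 * a₀, 5 * b₀ + 20 * a₀ ^ 2, by positivity, by positivity, fun η hη => ?_⟩
  have hη2 : 0 < η ^ 2 := pow_pos hη 2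
  -- the factors
  have factor : ∀ {ρ : ℝ × ℝ × ℝ → ℝ}, ContDiff ℝ 2 ρ →
      (∀ (p : ℝ × ℝ × ℝ) (i j : Fin 3), (fderiv ℝ ρ p (e i)) ^ 2 ≤ K * ρ p ∧
        |fderiv ℝ (fun q => fderiv ℝ ρ q (e i)) p (e j)| ≤ K₂) →
      ContDiff ℝ 2 (fun q => ζ (ρ q / η ^ 2)) ∧ (∀ q, 0 ≤ ζ (ρ q / η ^ 2) ∧ ζ (ρ q / η ^ 2) ≤ 1) ∧
        ∀ (p : ℝ × ℝ × ℝ) (i j : Fin 3), |fderiv ℝ (fun q => ζ (ρ q / η ^ 2)) p (e i)| ≤ a₀ / η ∧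
          |fderiv ℝ (fun q => ζ (ρ q / η ^ 2)) p (e j)| ≤ a₀ / η ∧
          |fderiv ℝ (fun q => fderiv ℝ (fun r => ζ (ρ r / η ^ 2)) q (e i)) p (e j)| ≤ b₀ / η ^ 2 := by
    intro ρ hρC hB
    refine ⟨hζC.comp (hρC.div_const _), fun q => hζ01 _, fun p i j => ?_⟩
    obtain ⟨-, -, -, d1, d2⟩ := cutoff_scale_bounds_gen hζC hζ01 hζ0 hζ1 hζd0 hZ hρC hη hK (e i) (e j) p
      (hB p i j).1 (hB p j i).1 (hB p i j).2
    obtain ⟨-, -, -, d1', -⟩ := cutoff_scale_bounds_gen hζC hζ01 hζ0 hζ1 hζd0 hZ hρC hη hK (e j) (e j) p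
      (hB p j j).1 (hB p j j).1 (hB p j j).2
    exact ⟨d1, d1', d2⟩
  obtain ⟨F1, G1, D1⟩ := factor C1 B1
  obtain ⟨F2, G2, D2⟩ := factor C2 B2
  obtain ⟨F3, G3, D3⟩ := factor C3 B3
  obtain ⟨F4, G4, D4⟩ := factor C4 B4
  obtain ⟨F5, G5, D5⟩ := factor C5 B5
  refine ⟨fun q => ζ (ρ₁ q / η ^ 2) * ζ (ρ₂ q / η ^ 2) * ζ (ρ₃ q / η ^ 2) * ζ (ρ₄ q / η ^ 2) * ζ (ρ₅ q / η ^ 2),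
    ?_, ?_, ?_, ?_, ?_, ?_, ?_, ?_⟩
  · exact (((F1.mul F2).mul F3).mul F4).mul F5
  · intro p
    have m : ∀ {x y : ℝ}, (0 ≤ x ∧ x ≤ 1) → (0 ≤ y ∧ y ≤ 1) → 0 ≤ x * y ∧ x * y ≤ 1 := fun hx hy =>
      ⟨mul_nonneg hx.1 hy.1, by nlinarith [hx.1, hx.2, hy.1, hy.2]⟩
    exact m (m (m (m (G1 p) (G2 p)) (G3 p)) (G4 p)) (G5 p)
  · intro q; simp only [P1a, P2a, P3a, P4a, P5a]
  · intro q; simp only [P1b, P2b, P3b, P4b, P5b]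
  · intro q; simp only [P1c, P2c, P3c, P4c, P5c]
  · -- vanishing near the zero sets
    intro p hp
    have van : ∀ {ρ : ℝ × ℝ × ℝ → ℝ}, ContDiff ℝ 2 ρ → ρ p < η ^ 2 →
        ∀ᶠ q in 𝓝 p, ζ (ρ q / η ^ 2) = 0 := fun hρC hlt => by
      have := cutoff_vanishes_near hζ0 hρC.continuous hη hlt
      exact this.mono fun q hq => by simpa using hq
    have hp' : ρ₁ p < η ^ 2 ∨ ρ₂ p < η ^ 2 ∨ ρ₃ p < η ^ 2 ∨ ρ₄ p < η ^ 2 ∨ ρ₅ p < η ^ 2 := by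
      rw [hρ₁, hρ₂, hρ₃, hρ₄, hρ₅]; exact hp
    rcases hp' with h | h | h | h | h
    · filter_upwards [van C1 h] with q hq; simp only [hq, zero_mul, Pi.zero_apply]
    · filter_upwards [van C2 h] with q hq; simp only [hq, mul_zero, zero_mul, Pi.zero_apply]
    · filter_upwards [van C3 h] with q hq; simp only [hq, mul_zero, zero_mul, Pi.zero_apply]
    · filter_upwards [van C4 h] with q hq; simp only [hq, mul_zero, zero_mul, Pi.zero_apply]
    · filter_upwards [van C5 h] with q hq; simp only [hq, mul_zero, Pi.zero_apply]
  · -- equal to one off the transition shells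
    intro p h1 h2 h3 h4 h5
    have one : ∀ {ρ : ℝ × ℝ × ℝ → ℝ}, 4 * η ^ 2 ≤ ρ p → ζ (ρ p / η ^ 2) = 1 := fun h =>
      hζ1 _ ((le_div_iff₀ hη2).2 h)
    have e1 : 4 * η ^ 2 ≤ ρ₁ p := by rw [hρ₁]; exact h1
    have e2 : 4 * η ^ 2 ≤ ρ₂ p := by rw [hρ₂]; exact h2
    have e3 : 4 * η ^ 2 ≤ ρ₃ p := by rw [hρ₃]; exact h3
    have e4 : 4 * η ^ 2 ≤ ρ₄ p := by rw [hρ₄]; exact h4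
    have e5 : 4 * η ^ 2 ≤ ρ₅ p := by rw [hρ₅]; exact h5
    simp only [one e1, one e2, one e3, one e4, one e5, mul_one]
  · -- derivative bounds: four product stages
    intro p i j
    obtain ⟨a1, a1', c1⟩ := D1 p i j
    obtain ⟨a2, a2', c2⟩ := D2 p i j
    obtain ⟨a3, a3', c3⟩ := D3 p i j
    obtain ⟨a4, a4', c4⟩ := D4 p i j
    obtain ⟨a5, a5', c5⟩ := D5 p i j
    obtain ⟨F12, G12, u12, v12, w12⟩ := cutoff_stage F1 F2 G1 G2 hη p (e i) (e j) a1 a1' a2 a2' c1 c2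
    obtain ⟨F123, G123, u123, v123, w123⟩ := cutoff_stage F12 F3 G12 G3 hη p (e i) (e j) u12 v12 a3 a3' w12 c3
    obtain ⟨F1234, G1234, u1234, v1234, w1234⟩ :=
      cutoff_stage F123 F4 G123 G4 hη p (e i) (e j) u123 v123 a4 a4' w123 c4
    obtain ⟨-, -, u5, -, w5⟩ := cutoff_stage F1234 F5 G1234 G5 hη p (e i) (e j) u1234 v1234 a5 a5' w1234 c5
    refine ⟨u5.trans (le_of_eq (by ring)), w5.trans (le_of_eq (by ring))⟩

end Summit.AtomisticToContinuum.FouriersLaw.Theorems.DrudeDissolution.KineticPolymerGasOnTheTimeAxis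

end
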